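import Literature.NumberTheory.Automorphic.UnitaryGroupArchSiegelSquares
import Literature.NumberTheory.Automorphic.UnitaryGroupArchRealPair
import Literature.NumberTheory.Automorphic.UnitaryGroupDoubledSiegelSquaresReps
import Literature.LinearAlgebra.Matrix.GeneralLinearGroupSquaresReal
import Literature.LinearAlgebra.Matrix.GeneralLinearGroupSquaresPiReps
import HarnessLib

/-!
# The archimedean Siegel parabolic `P_Δ(E ⊗ ℝ)` modulo squares, for `E` with real places: Levi sign representatives

Topic `NumberTheory/Automorphic`; namespace `Literature.NumberTheory.Automorphic` (sub-namespaces `DoubledUnitary`,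
`UnitaryGroup`).  KERNEL only: proved theorems, no definition, no named fact, no `sorry`.

Companion of `UnitaryGroupArchSiegelSquares` (the totally complex case, where `P_Δ(E ⊗ ℝ)` is generated by squares) for a
number field `E` WITH real places: `E ⊗_ℚ ℝ = mixedSpace E = ℝ^{r₁} × ℂ^{r₂}` and `GL_ι(ℝ)` is NOT generated by squares
(`⟨squares⟩ = GL_ι(ℝ)⁺`, [Artin1988, Chap. IV Thm. 4.6–4.7], the tree's `GeneralLinearGroupSquaresReal`).  What survives:

* `DoubledUnitary.exists_list_sq_mul_levi_of_isSiegelReindex` — ring level, re-enumerated consumer form of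
  `DoubledUnitary.exists_list_sq_mul_levi_of_isSiegel_blocks`: for `σ` an involution of `R` with `2 ∈ Rˣ`, `S` symmetric
  `σ`-fixed of unit determinant, `J = reindex e e (S ⊕ −S)` and a set `Rset ⊆ GL_ι(R)` with `GL_ι(R) = ⟨squares⟩ · Rset`,
  every `γ ∈ P_Δ ≤ U(σ, J)` is `(∏ qᵢ²) · q` with `qᵢ, q ∈ P_Δ` and `2 · reindex e⁻¹ e⁻¹ q = C · diag(r, τ⁻¹ σ(r⁻¹)ᵀ τ) · C`,
  `r ∈ Rset`, `C = [[1,1],[1,−1]]`, `τ = S + S` (the Levi element `m(r)` in the Cayley basis);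
* **`UnitaryGroup.exists_list_sq_mul_levi_of_isSiegel_archToAdelic`** (and `…_of_base` for a form
  `(reindex e e (T ⊕ −T)) ⊗ 1` defined over `F`, the literal shape of GR-2's `hermD`) — for an involution `c` of `E/F`,
  `S₀ ∈ M_ι(E)` symmetric `c`-fixed of unit determinant, `J = reindex e e (S₀ ⊕ −S₀)`, and any chosen family
  `ε_w ∈ GL_ι(ℝ)` of negative determinant indexed by the real places `w` of `E`: every `g ∈ U(J)(E ⊗ ℝ)` with
  `archToAdelic g ∈ P_Δ(𝔸)` is `(l.map (q ↦ q²)).prod * q` with all factors in `P_Δ` and `q = m(r)` the Cayley–Levi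
  element of a **sign pattern** `r ∈ GL_ι(E ⊗ ℝ)`: `r_w ∈ {1, ε_w}` at the real places, `r_w = 1` at the complex ones
  (§0 `GeneralLinearGroup.exists_mem_closure_isSquare_mul_eq_realComplex` of this file; coordinates read by the tree's
  `UnitaryGroup.evalR` / `UnitaryGroup.evalC`).

Use (stage-1 cell `pub-hodgecm`, GR lane Track 2 = [GelbartRogawski1991, Prop. 3.1.1] for general `(F, E, σ)`, type-(ii)
= real places of `E`): a `{±1}`-valued multiplicative function on `P_Δ(E ⊗ ℝ)` (the quotient `κ/τ` of two candidate
splittings) kills the squares, so it is determined by its values on the `2^{r₁(E)}` Levi sign representatives `m(r)`;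
for `E` totally complex there are no real places, `r = 1`, and one recovers `exists_list_sq_of_isSiegel_archToAdelic`.

## References

* M. Harris, S. S. Kudla, W. J. Sweet, J. Amer. Math. Soc. 9 (1996), §1 (1.9)–(1.12) [HarrisKudlaSweet1996].
* E. Artin, *Geometric Algebra*, Chap. IV Thm. 4.6–4.7 [Artin1988].
* A. Borel, H. Jacquet, PSPM 33.1 (1979), §4.1 [BorelJacquet1979].
-/

set_option autoImplicit false

noncomputable section

open NumberField NumberField.mixedEmbedding NumberField.InfinitePlace IsDedekindDomain Matrix
open scoped MatrixGroups

/-! ## §0 `GL_ι(ℝ^{κ₁} × ℂ^{κ₂})` modulo squares: sign patterns on the real coordinates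

(Layer `LinearAlgebra/Matrix` content, namespace `Literature.LinearAlgebra.Matrix.GeneralLinearGroup`, kept in this file next to
its only consumer.)  `GL_ι(ℂ)` is generated by squares (`closure_isSquare_eq_top_of_isAlgClosed`), `GL_ι(ℝ) = ⟨squares⟩ · {1, ε}`
for any `ε` of negative determinant (`GeneralLinearGroupSquaresReal.exists_mem_closure_isSquare_mul_eq_real`), hence every
`g ∈ GL_ι(ℝ^{κ₁} × ℂ^{κ₂})` is `u · r` with `u` a product of squares and `r` a sign pattern, and a square-killing homomorphism
into a commutative monoid killing the one-coordinate elements `ε̂_k` is trivial. [cite: Artin1988, Chap. IV Thm. 4.6–4.7] -/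

namespace Literature.LinearAlgebra.Matrix.GeneralLinearGroup

variable {ι : Type*} [Fintype ι] [DecidableEq ι]

/-- **`GL_ι(ℝ^{κ₁} × ℂ^{κ₂})` modulo squares: sign patterns on the real coordinates.**  For any chosen `ε_k ∈ GL_ι(ℝ)` of negative
determinant (`k ∈ κ₁`), every `g ∈ GL_ι((κ₁ → ℝ) × (κ₂ → ℂ))` is `u · r` with `u` a product of squares, `r_{k} ∈ {1, ε_k}` at the real
coordinates and `r_{k} = 1` at the complex ones. [cite: Artin1988, Chap. IV Thm. 4.7] -/
theorem exists_mem_closure_isSquare_mul_eq_realComplex {κ₁ κ₂ : Type*} [Fintype κ₁] [DecidableEq κ₁] [Fintype κ₂] [DecidableEq κ₂]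
    (ε : κ₁ → GL ι ℝ) (hε : ∀ k, ((ε k : GL ι ℝ) : Matrix ι ι ℝ).det < 0)
    (g : GL ι ((κ₁ → ℝ) × (κ₂ → ℂ))) :
    ∃ u ∈ Subgroup.closure {g : GL ι ((κ₁ → ℝ) × (κ₂ → ℂ)) | IsSquare g},
      ∃ r : GL ι ((κ₁ → ℝ) × (κ₂ → ℂ)), g = u * r ∧
        (∀ k, Matrix.GeneralLinearGroup.map (((Pi.evalRingHom (fun _ : κ₁ => ℝ) k).comp (RingHom.fst (κ₁ → ℝ) (κ₂ → ℂ)))) r = 1 ∨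
          Matrix.GeneralLinearGroup.map (((Pi.evalRingHom (fun _ : κ₁ => ℝ) k).comp (RingHom.fst (κ₁ → ℝ) (κ₂ → ℂ)))) r = ε k) ∧
        (∀ k, Matrix.GeneralLinearGroup.map (((Pi.evalRingHom (fun _ : κ₂ => ℂ) k).comp (RingHom.snd (κ₁ → ℝ) (κ₂ → ℂ)))) r = 1) :=
  exists_mem_closure_isSquare_mul_eq_of_components (fun _ => ℝ) (fun _ => ℂ) ε
    (fun k g => exists_mem_closure_isSquare_mul_eq_real (hε k) g)
    (fun _ => closure_isSquare_eq_top_of_isAlgClosed) g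

/-- **a square-killing homomorphism `GL_ι(ℝ^{κ₁} × ℂ^{κ₂}) →* M` (`M` commutative) that kills, for each real coordinate
`k`, one element `ε̂_k` with `(ε̂_k)_k = ε_k` (`det ε_k < 0`) and all other coordinates `1`, is trivial** — the uniqueness
skeleton for sign-type characters of `GL_ι(E ⊗ ℝ)`: `#κ₁` conditions. [cite: Artin1988, Chap. IV Thm. 4.7] -/
theorem monoidHom_eq_one_realComplex {κ₁ κ₂ : Type*} [Fintype κ₁] [DecidableEq κ₁] [Fintype κ₂] [DecidableEq κ₂]
    {M : Type*} [CommMonoid M] (ε : κ₁ → GL ι ℝ) (hε : ∀ k, ((ε k : GL ι ℝ) : Matrix ι ι ℝ).det < 0)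
    (f : GL ι ((κ₁ → ℝ) × (κ₂ → ℂ)) →* M) (hsq : ∀ g, f (g * g) = 1)
    (hεf : ∀ (k) (g : GL ι ((κ₁ → ℝ) × (κ₂ → ℂ))),
      Matrix.GeneralLinearGroup.map (((Pi.evalRingHom (fun _ : κ₁ => ℝ) k).comp (RingHom.fst (κ₁ → ℝ) (κ₂ → ℂ)))) g = ε k →
      (∀ k', k' ≠ k →
        Matrix.GeneralLinearGroup.map (((Pi.evalRingHom (fun _ : κ₁ => ℝ) k').comp (RingHom.fst (κ₁ → ℝ) (κ₂ → ℂ)))) g = 1) →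
      (∀ k', Matrix.GeneralLinearGroup.map (((Pi.evalRingHom (fun _ : κ₂ => ℂ) k').comp (RingHom.snd (κ₁ → ℝ) (κ₂ → ℂ)))) g = 1) →
      f g = 1) :
    f = 1 :=
  monoidHom_eq_one_of_components (fun _ => ℝ) (fun _ => ℂ) ε
    (fun k g => exists_mem_closure_isSquare_mul_eq_real (hε k) g)
    (fun _ => closure_isSquare_eq_top_of_isAlgClosed) f hsq hεf

end Literature.LinearAlgebra.Matrix.GeneralLinearGroup

namespace Literature.NumberTheory.Automorphic

/-! ## 1. Ring level: the re-enumerated consumer form with a Levi representative -/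

namespace DoubledUnitary

section Ring

variable {R : Type*} [CommRing R] (σ : R →+* R) {ι : Type*} [Fintype ι] [DecidableEq ι]

/-- packaging: a product of squares of elements of a subgroup `U` satisfying `P`, times an element of `U`, typed on `U`.
[folklore] -/
private theorem exists_list_subtype_mul {G : Type*} [Group G] (U : Subgroup G) (P : G → Prop) :
    ∀ (l : List G) (g : U), (∀ q ∈ l, q ∈ U ∧ P q) → ∀ r : G, r ∈ U → (g : G) = (l.map fun q => q * q).prod * r →
      ∃ (l' : List U) (r' : U), (∀ q ∈ l', P (q : G)) ∧ (r' : G) = r ∧ g = (l'.map fun q => q * q).prod * r' := by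
  intro l
  induction l with
  | nil =>
    intro g _ r hr hg
    refine ⟨[], ⟨r, hr⟩, fun q hq => by simp at hq, rfl, Subtype.ext ?_⟩
    simpa using hg
  | cons q l ih =>
    intro g hl r hr hg
    have hq : q ∈ U ∧ P q := hl q (List.mem_cons_self)
    have hl' : ∀ q' ∈ l, q' ∈ U ∧ P q' := fun q' hq' => hl q' (List.mem_cons_of_mem q hq')
    rw [List.map_cons, List.prod_cons, mul_assoc] at hg
    have hrest : (l.map fun q => q * q).prod * r ∈ U := by
      have : (l.map fun q => q * q).prod * r = (q * q)⁻¹ * (g : G) := by rw [hg, inv_mul_cancel_left]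
      rw [this]
      exact mul_mem (inv_mem (mul_mem hq.1 hq.1)) g.2
    obtain ⟨l', r', hl'P, hr', hl'eq⟩ := ih ⟨_, hrest⟩ hl' r hr rfl
    refine ⟨⟨q, hq.1⟩ :: l', r', fun q' hq' => ?_, hr', Subtype.ext ?_⟩
    · rw [List.mem_cons] at hq'
      rcases hq' with rfl | hq'
      · exact hq.2
      · exact hl'P q' hq'
    · have key := congrArg (fun x : U => (x : G)) hl'eq
      simp only [Subgroup.coe_mul] at key
      rw [List.map_cons, List.prod_cons, Subgroup.coe_mul, Subgroup.coe_mul, mul_assoc, ← key, hg]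
      rfl

omit [CommRing R] [Fintype ι] [DecidableEq ι] in
/-- `reindex e.symm e.symm (reindex e e M) = M`. [folklore] -/
private theorem reindex_symm_reindex'' {m : Type*} (e : ι ⊕ ι ≃ m) (M : Matrix (ι ⊕ ι) (ι ⊕ ι) R) :
    Matrix.reindex e.symm e.symm (Matrix.reindex e e M) = M := by
  simp

/-- **`P_Δ` of `U(σ, reindex e e (S ⊕ −S))` modulo squares: Levi representatives** (re-enumerated consumer form of
`exists_list_sq_mul_levi_of_isSiegel_blocks`).  For `σ` an involution of a commutative ring `R` with `2 ∈ Rˣ`, `S` symmetric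
`σ`-fixed of unit determinant, a set `Rset ⊆ GL_ι(R)` with `GL_ι(R) = ⟨squares⟩ · Rset`, and `γ ∈ U(σ, J)`,
`J = reindex e e (S ⊕ −S)`, satisfying the Siegel condition `IsSiegelReindex e`: `γ = (∏ qᵢ²) · q` with all `qᵢ ∈ P_Δ`,
`q ∈ P_Δ`, and `2 · reindex e⁻¹ e⁻¹ q = C · diag(r, τ⁻¹σ(r⁻¹)ᵀτ) · C` for some `r ∈ Rset` (`C = [[1,1],[1,−1]]`, `τ = S + S`).
[cite: HarrisKudlaSweet1996, §1 (1.11)] -/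
theorem exists_list_sq_mul_levi_of_isSiegelReindex {m : Type*} [Fintype m] [DecidableEq m] (e : ι ⊕ ι ≃ m)
    (hσ : ∀ x, σ (σ x) = x) (h2 : IsUnit (2 : R))
    {S : Matrix ι ι R} (hSσ : S.map σ = S) (hSs : Sᵀ = S) (hSu : IsUnit S.det)
    {Rset : Set (GL ι R)}
    (hGL : ∀ A : GL ι R, ∃ u ∈ Subgroup.closure {A : GL ι R | IsSquare A}, ∃ r ∈ Rset, A = u * r)
    (J : Matrix m m R) (hJ : J = Matrix.reindex e e (Matrix.fromBlocks S 0 0 (-S)))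
    (γ : unitaryGroupOfForm σ J) (hγ : IsSiegelReindex e (γ : GL m R)) :
    ∃ (l : List (unitaryGroupOfForm σ J)) (r : GL ι R) (q : unitaryGroupOfForm σ J),
      (∀ q' ∈ l, IsSiegelReindex e ((q' : unitaryGroupOfForm σ J) : GL m R)) ∧ r ∈ Rset ∧
      IsSiegelReindex e ((q : unitaryGroupOfForm σ J) : GL m R) ∧
      (2 : R) • Matrix.reindex e.symm e.symm (((q : unitaryGroupOfForm σ J) : GL m R) : Matrix m m R) =
        Matrix.fromBlocks (1 : Matrix ι ι R) (1 : Matrix ι ι R) (1 : Matrix ι ι R) (-1 : Matrix ι ι R) *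
          Matrix.fromBlocks (r : Matrix ι ι R) 0 0 ((S + S)⁻¹ * (((r⁻¹ : GL ι R) : Matrix ι ι R).map σ)ᵀ * (S + S)) *
          Matrix.fromBlocks (1 : Matrix ι ι R) (1 : Matrix ι ι R) (1 : Matrix ι ι R) (-1 : Matrix ι ι R) ∧
      γ = (l.map fun q' => q' * q').prod * q := by
  subst hJ
  set ψ : GL (ι ⊕ ι) R ≃* GL m R := Units.mapEquiv (Matrix.reindexRingEquiv R e).toMulEquiv with hψ
  have hsub : (Matrix.reindex e e (Matrix.fromBlocks S 0 0 (-S))).submatrix e e = Matrix.fromBlocks S 0 0 (-S) := by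
    rw [Matrix.reindex_apply, Matrix.submatrix_submatrix, Equiv.symm_comp_self, Matrix.submatrix_id_id]
  have hmem : ∀ g : GL (ι ⊕ ι) R, g ∈ unitaryGroupOfForm σ (Matrix.fromBlocks S 0 0 (-S)) ↔
      ψ g ∈ unitaryGroupOfForm σ (Matrix.reindex e e (Matrix.fromBlocks S 0 0 (-S))) := by
    intro g
    have key := reindex_mem_unitaryGroupOfForm_iff σ e (Matrix.reindex e e (Matrix.fromBlocks S 0 0 (-S))) g
    rwa [hsub] at key
  have hcoeψ : ∀ g : GL (ι ⊕ ι) R, ((ψ g : GL m R) : Matrix m m R) = Matrix.reindex e e (g : Matrix (ι ⊕ ι) (ι ⊕ ι) R) :=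
    fun g => rfl
  have hsieg : ∀ g : GL (ι ⊕ ι) R, IsSiegelReindex e (ψ g) ↔
      (g : Matrix (ι ⊕ ι) (ι ⊕ ι) R).toBlocks₁₁ + (g : Matrix (ι ⊕ ι) (ι ⊕ ι) R).toBlocks₁₂ =
        (g : Matrix (ι ⊕ ι) (ι ⊕ ι) R).toBlocks₂₁ + (g : Matrix (ι ⊕ ι) (ι ⊕ ι) R).toBlocks₂₂ := by
    intro g
    unfold IsSiegelReindex
    rw [hcoeψ, reindex_symm_reindex'']
  -- pull `γ` back to the block enumeration
  set g : GL (ι ⊕ ι) R := ψ.symm (γ : GL m R) with hg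
  have hψg : ψ g = (γ : GL m R) := ψ.apply_symm_apply _
  have hgU : g ∈ unitaryGroupOfForm σ (Matrix.fromBlocks S 0 0 (-S)) := by rw [hmem, hψg]; exact γ.2
  have hgP := (hsieg g).1 (by rw [hψg]; exact hγ)
  obtain ⟨l, r, q, hl, hr, hqU, hqP, hq2, hgl⟩ :=
    exists_list_sq_mul_levi_of_isSiegel_blocks σ hσ h2 hSσ hSs hSu hGL hgU hgP
  -- push the list and `q` forward along `ψ`
  have hl' : ∀ q' ∈ l.map ψ, q' ∈ unitaryGroupOfForm σ (Matrix.reindex e e (Matrix.fromBlocks S 0 0 (-S))) ∧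
      IsSiegelReindex e q' := by
    intro q' hq'
    rw [List.mem_map] at hq'
    obtain ⟨q₀, hq₀, rfl⟩ := hq'
    exact ⟨(hmem q₀).1 (hl q₀ hq₀).1, (hsieg q₀).2 (hl q₀ hq₀).2⟩
  have hγl : ((γ : unitaryGroupOfForm σ _) : GL m R) = ((l.map ψ).map fun q' => q' * q').prod * ψ q := by
    rw [← hψg, hgl, map_mul, map_list_prod, List.map_map, List.map_map]
    simp only [Function.comp_def, map_mul]
  obtain ⟨l', q', hl'P, hq', hγeq⟩ :=
    exists_list_subtype_mul _ (fun q' => IsSiegelReindex e q') (l.map ψ) γ hl' (ψ q) ((hmem q).1 hqU) hγl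
  refine ⟨l', r, q', hl'P, hr, ?_, ?_, hγeq⟩
  · rw [hq']
    exact (hsieg q).2 hqP
  · rw [hq', hcoeψ, reindex_symm_reindex'']
    exact hq2

end Ring

end DoubledUnitary

/-! ## 2. `P_Δ(E ⊗ ℝ)` modulo squares: Levi sign representatives at the real places of `E` -/

namespace UnitaryGroup

section Arch

variable (F E : Type) [Field F] [NumberField F] [Field E] [NumberField E] [Algebra F E] (c : E ≃ₐ[F] E) (N : ℕ)
  (J : Matrix (Fin N) (Fin N) E) {ι : Type*} [Fintype ι] [DecidableEq ι] (e : ι ⊕ ι ≃ Fin N)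

omit [NumberField F] [NumberField E] in
/-- `(c ⊗ 1)² = 1` on `E ⊗ ℝ` for an involution `c` (from the tree's `conjMixed_inv_apply`). [folklore] -/
private theorem conjMixed_conjMixed'' (hc : ∀ x, c (c x) = x) (x : mixedSpace E) :
    conjMixed F E c (conjMixed F E c x) = x := by
  have hcc : c * c = 1 := AlgEquiv.ext fun y => by rw [AlgEquiv.mul_apply, hc]; rfl
  have hinv : c⁻¹ = c := inv_eq_of_mul_eq_one_right hcc
  have h := conjMixed_inv_apply F E c x
  rwa [hinv] at h

/-- **`P_Δ(E ⊗ ℝ)` modulo squares is carried by `2^{r₁(E)}` Levi sign representatives.**  Let `c` be an involution of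
`E/F`, `S₀ ∈ M_ι(E)` symmetric, `c`-fixed, of unit determinant, `J = reindex e e (S₀ ⊕ −S₀)` the doubled hermitian form,
and `ε_w ∈ GL_ι(ℝ)` of negative determinant for each real place `w` of `E`.  Then every `g ∈ U(J)(E ⊗ ℝ)` with
`archToAdelic g ∈ P_Δ(𝔸)` (`DoubledUnitary.IsSiegelReindex e`) is `(l.map (q ↦ q * q)).prod * q` with all `q' ∈ l` and `q`
in `P_Δ`, and `2 · reindex e⁻¹ e⁻¹ q = C · diag(r, τ⁻¹ (c ⊗ 1)(r⁻¹)ᵀ τ) · C` (`C = [[1,1],[1,−1]]`, `τ = S + S`,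
`S = S₀ ⊗ 1`) for a sign pattern `r ∈ GL_ι(E ⊗ ℝ)`: `r_w ∈ {1, ε_w}` at the real places and `r_w = 1` at the complex
places of `E` — `P_Δ(E ⊗ ℝ) ≅ ∏_w GL_ι(E_w) ⋉ Herm`, `GL_ι(ℂ) = ⟨squares⟩`, `GL_ι(ℝ) = ⟨squares⟩ · {1, ε}`.
[cite: HarrisKudlaSweet1996, §1 (1.11)–(1.12)] -/
theorem exists_list_sq_mul_levi_of_isSiegel_archToAdelic (hc : ∀ x, c (c x) = x)
    {S₀ : Matrix ι ι E} (hS₀c : S₀.map (c : E →+* E) = S₀) (hS₀s : S₀ᵀ = S₀) (hS₀u : IsUnit S₀.det)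
    (hJ : J = Matrix.reindex e e (Matrix.fromBlocks S₀ 0 0 (-S₀)))
    (ε : {w : InfinitePlace E // w.IsReal} → GL ι ℝ) (hε : ∀ k, ((ε k : GL ι ℝ) : Matrix ι ι ℝ).det < 0)
    (g : arch F E c N J)
    (hg : DoubledUnitary.IsSiegelReindex e
      ((archToAdelic F E c N J g).1 : GL (Fin N) (AdeleRing (𝓞 E) E))) :
    ∃ (l : List (arch F E c N J)) (r : GL ι (mixedSpace E)) (q : arch F E c N J),
      (∀ q' ∈ l, DoubledUnitary.IsSiegelReindex e
        ((archToAdelic F E c N J q').1 : GL (Fin N) (AdeleRing (𝓞 E) E))) ∧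
      (∀ k, Matrix.GeneralLinearGroup.map (evalR E k) r = 1 ∨ Matrix.GeneralLinearGroup.map (evalR E k) r = ε k) ∧
      (∀ k, Matrix.GeneralLinearGroup.map (evalC E k) r = 1) ∧
      DoubledUnitary.IsSiegelReindex e ((archToAdelic F E c N J q).1 : GL (Fin N) (AdeleRing (𝓞 E) E)) ∧
      (2 : mixedSpace E) • Matrix.reindex e.symm e.symm
          (((q : arch F E c N J) : GL (Fin N) (mixedSpace E)) : Matrix (Fin N) (Fin N) (mixedSpace E)) =
        Matrix.fromBlocks (1 : Matrix ι ι (mixedSpace E)) 1 1 (-1) *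
          Matrix.fromBlocks (r : Matrix ι ι (mixedSpace E)) 0 0
            ((S₀.map (mixedEmbedding E) + S₀.map (mixedEmbedding E))⁻¹ *
              (((r⁻¹ : GL ι (mixedSpace E)) : Matrix ι ι (mixedSpace E)).map (conjMixed F E c))ᵀ *
              (S₀.map (mixedEmbedding E) + S₀.map (mixedEmbedding E))) *
          Matrix.fromBlocks (1 : Matrix ι ι (mixedSpace E)) 1 1 (-1) ∧
      g = (l.map fun q' => q' * q').prod * q := by
  classical
  -- the data of `UnitaryGroupDoubledSiegelSquaresReps` over `R = E ⊗ ℝ`, `σ = c ⊗ 1`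
  set S : Matrix ι ι (mixedSpace E) := S₀.map (mixedEmbedding E) with hS
  have hσ : ∀ x, conjMixed F E c (conjMixed F E c x) = x := conjMixed_conjMixed'' F E c hc
  have h2 : IsUnit (2 : mixedSpace E) := by
    have : (2 : mixedSpace E) = algebraMap ℝ (mixedSpace E) 2 := by rw [map_ofNat]
    rw [this]
    exact (isUnit_iff_ne_zero.2 two_ne_zero).map _
  have hSσ : S.map (conjMixed F E c) = S := by
    rw [hS, Matrix.map_map]
    have : (⇑(conjMixed F E c) ∘ ⇑(mixedEmbedding E) : E → mixedSpace E) = ⇑(mixedEmbedding E) ∘ ⇑(c : E →+* E) :=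
      funext fun x => conjMixed_mixedEmbedding F E c x
    rw [this, ← Matrix.map_map, hS₀c]
  have hSs : Sᵀ = S := by rw [hS, ← Matrix.transpose_map, hS₀s]
  have hSu : IsUnit S.det := by
    rw [hS, ← RingHom.mapMatrix_apply, ← RingHom.map_det]
    exact hS₀u.map _
  -- `GL_ι(E ⊗ ℝ) = ⟨squares⟩ · (sign patterns)`
  have hGL : ∀ A : GL ι (mixedSpace E), ∃ u ∈ Subgroup.closure {A : GL ι (mixedSpace E) | IsSquare A},
      ∃ r ∈ {r : GL ι (mixedSpace E) |
        (∀ k, Matrix.GeneralLinearGroup.map (evalR E k) r = 1 ∨ Matrix.GeneralLinearGroup.map (evalR E k) r = ε k) ∧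
        (∀ k, Matrix.GeneralLinearGroup.map (evalC E k) r = 1)},
        A = u * r := by
    intro A
    obtain ⟨u, hu, r, hAr, hr₁, hr₂⟩ :=
      Literature.LinearAlgebra.Matrix.GeneralLinearGroup.exists_mem_closure_isSquare_mul_eq_realComplex ε hε A
    exact ⟨u, hu, r, ⟨hr₁, hr₂⟩, hAr⟩
  have hJ' : archFormOf E N J = Matrix.reindex e e (Matrix.fromBlocks S 0 0 (-S)) := by
    rw [archFormOf, hJ, reindex_fromBlocks_neg_map, ← hS]
  -- the Siegel condition of `archToAdelic q = (q, 1)` is that of `q`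
  have hiff : ∀ q : arch F E c N J, DoubledUnitary.IsSiegelReindex e
      ((archToAdelic F E c N J q).1 : GL (Fin N) (AdeleRing (𝓞 E) E)) ↔
        DoubledUnitary.IsSiegelReindex e (q : GL (Fin N) (mixedSpace E)) :=
    fun q => isSiegelReindex_ofInfinite_iff E N e (q : GL (Fin N) (mixedSpace E))
  obtain ⟨l, r, q, hl, hr, hqP, hq2, hgl⟩ :=
    DoubledUnitary.exists_list_sq_mul_levi_of_isSiegelReindex (conjMixed F E c) e hσ h2 hSσ hSs hSu hGL
      (archFormOf E N J) hJ' g ((hiff g).1 hg)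
  exact ⟨l, r, q, fun q' hq' => (hiff q').2 (hl q' hq'), hr.1, hr.2, (hiff q).2 hqP, hq2, hgl⟩

/-- **The same, for a doubled form defined over the base field** — the shape of GR-2's `hermD = (reindex e₂ e₂ (T ⊕ −T)) ⊗ 1`
with `T ∈ M_ι(F)` symmetric of unit determinant (`S₀ = T ⊗ 1`, so `S = T ⊗ 1 ⊗ 1` and `τ = S + S`): every
`g ∈ U(J)(E ⊗ ℝ)` with `archToAdelic g ∈ P_Δ(𝔸)` is a product of squares of elements of `P_Δ(E ⊗ ℝ)` times the Cayley–Levi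
element of a sign pattern `r` (`r_w ∈ {1, ε_w}` at real `w`, `r_w = 1` at complex `w`).
[cite: HarrisKudlaSweet1996, §1 (1.11)–(1.12)] -/
theorem exists_list_sq_mul_levi_of_isSiegel_archToAdelic_of_base (hc : ∀ x, c (c x) = x)
    {T : Matrix ι ι F} (hTs : Tᵀ = T) (hTu : IsUnit T.det)
    (hJ : J = (Matrix.reindex e e (Matrix.fromBlocks T 0 0 (-T))).map (algebraMap F E))
    (ε : {w : InfinitePlace E // w.IsReal} → GL ι ℝ) (hε : ∀ k, ((ε k : GL ι ℝ) : Matrix ι ι ℝ).det < 0)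
    (g : arch F E c N J)
    (hg : DoubledUnitary.IsSiegelReindex e ((archToAdelic F E c N J g).1 : GL (Fin N) (AdeleRing (𝓞 E) E))) :
    ∃ (l : List (arch F E c N J)) (r : GL ι (mixedSpace E)) (q : arch F E c N J),
      (∀ q' ∈ l, DoubledUnitary.IsSiegelReindex e
        ((archToAdelic F E c N J q').1 : GL (Fin N) (AdeleRing (𝓞 E) E))) ∧
      (∀ k, Matrix.GeneralLinearGroup.map (evalR E k) r = 1 ∨ Matrix.GeneralLinearGroup.map (evalR E k) r = ε k) ∧
      (∀ k, Matrix.GeneralLinearGroup.map (evalC E k) r = 1) ∧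
      DoubledUnitary.IsSiegelReindex e ((archToAdelic F E c N J q).1 : GL (Fin N) (AdeleRing (𝓞 E) E)) ∧
      (2 : mixedSpace E) • Matrix.reindex e.symm e.symm
          (((q : arch F E c N J) : GL (Fin N) (mixedSpace E)) : Matrix (Fin N) (Fin N) (mixedSpace E)) =
        Matrix.fromBlocks (1 : Matrix ι ι (mixedSpace E)) 1 1 (-1) *
          Matrix.fromBlocks (r : Matrix ι ι (mixedSpace E)) 0 0
            (((T.map (algebraMap F E)).map (mixedEmbedding E) + (T.map (algebraMap F E)).map (mixedEmbedding E))⁻¹ *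
              (((r⁻¹ : GL ι (mixedSpace E)) : Matrix ι ι (mixedSpace E)).map (conjMixed F E c))ᵀ *
              ((T.map (algebraMap F E)).map (mixedEmbedding E) + (T.map (algebraMap F E)).map (mixedEmbedding E))) *
          Matrix.fromBlocks (1 : Matrix ι ι (mixedSpace E)) 1 1 (-1) ∧
      g = (l.map fun q' => q' * q').prod * q := by
  refine exists_list_sq_mul_levi_of_isSiegel_archToAdelic F E c N J e hc (S₀ := T.map (algebraMap F E)) ?_ ?_ ?_ ?_
    ε hε g hg
  · rw [Matrix.map_map]
    have : (⇑(c : E →+* E) ∘ ⇑(algebraMap F E) : F → E) = ⇑(algebraMap F E) := funext fun x => c.commutes x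
    rw [this]
  · rw [← Matrix.transpose_map, hTs]
  · rw [← RingHom.mapMatrix_apply, ← RingHom.map_det]
    exact hTu.map _
  · rw [hJ, reindex_fromBlocks_neg_map]

end Arch

end UnitaryGroup

end Literature.NumberTheory.Automorphic
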